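import Summits.AtomisticToContinuum.Crystallization.Theses.ThreeConeCertificate
import Summits.AtomisticToContinuum.Crystallization.Theorems.ChargedEnergyGap.Negative.BlocksBound
import Literature.MathematicalPhysics.StatisticalMechanics.LennardJonesThermodynamicLimitProofs

/-!
# Route ThreeConeCertificate — item `TrialStateUpper` (stmt-AtomisticToContinuum-11963)

The trial-state upper bound per periodic configuration for the Lennard-Jones gas in `ℝ³`:
for every periodic configuration `Q` and every `ε > 0`, eventually in `N`,
`E(N)/N ≤ e(Q) + ε`.

Proof: by the thermodynamic limit (`BlancLewin2015_8_holds`, Blanc–Lewin 2015 §1.3 (8):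
`E(N)/N → e_∞` for `1 ≤ d ≤ 5`) and the blocks-of-`Q` trial-state bound already in the tree
(`le_energyPerParticle_of_tendsto`: `e_∞ ≤ e(Q)`, finite blocks of a periodic configuration are
admissible injective trial states whose boundary losses are `o(K³)`), the sequence `E(N)/N` is
eventually below `e_∞ + ε ≤ e(Q) + ε`. [folklore; BlancLewin2015 §2.1]
-/

noncomputable section

namespace Summit.AtomisticToContinuum.Crystallization.Theorems

open Literature.MathematicalPhysics.StatisticalMechanics
open Summit.AtomisticToContinuum.Crystallization.Theorems.ChargedEnergyGapNegative

/-- **Trial-state upper bound** (item `stmt-AtomisticToContinuum-11963`, route decl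
`ThreeConeCertificate.TrialStateUpper`): for every periodic configuration `Q` of `ℝ³` and every
`ε > 0`, eventually `E(N)/N ≤ e(Q) + ε` for the Lennard-Jones ground-state energy `E(N)`.
From `BlancLewin2015_8_holds` (`E(N)/N → e_∞`) and `le_energyPerParticle_of_tendsto`
(`e_∞ ≤ e(Q)`). [folklore; BlancLewin2015 §1.3 (8), §2.1] -/
theorem trialStateUpper_proof :
    Summit.AtomisticToContinuum.Crystallization.Theses.ThreeConeCertificate.TrialStateUpper := by
  unfold Summit.AtomisticToContinuum.Crystallization.Theses.ThreeConeCertificate.TrialStateUpper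
  intro Q ε hε
  obtain ⟨e, -, htend, -⟩ := BlancLewin2015_8_holds 3 (by norm_num) (by norm_num)
  have hle : e ≤ Q.energyPerParticle lennardJones := le_energyPerParticle_of_tendsto htend Q
  have hlt : e < Q.energyPerParticle lennardJones + ε := by linarith
  filter_upwards [htend.eventually (gt_mem_nhds hlt)] with N hN
  exact hN.le

end Summit.AtomisticToContinuum.Crystallization.Theorems

end
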